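import Mathlib.Analysis.InnerProductSpace.PiL2
import Mathlib.Analysis.SpecialFunctions.Complex.Arg
import Mathlib.Analysis.SpecialFunctions.Trigonometric.Bounds
import Mathlib.Analysis.SpecialFunctions.Trigonometric.Inverse
import Mathlib.Analysis.Real.Pi.Bounds
import Mathlib.Data.Set.Card
import Summits.AtomisticToContinuum.Crystallization.Theorems.HullExactificationCascadeZeroDefectDensityLinkLemma
import HarnessLib

/-!
# Soft Lemma 7 for the birth line: at most four soft contacts per shell point
# (route `HullExactificationCascade`, crux `ZeroDefectDensity`, stmt-AtomisticToContinuum-12086; line `birth`,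
# stub `stub_softDegreeLeFour`, registered signature verbatim)

Datum: a centre `u` and twelve points `p : Fin 12 → ℝ³` with `dist u (p i) ∈ [1 - η, 1 + η]`,
`η = 1/4000`, and pairwise distances either in `[1 - η, 1 + η]` (soft contact) or `≥ 7/5` (gap).
Claim: every `p i` has at most four soft contacts among the other eleven — the soft form of
Hales, arXiv:1209.6043, Lemma 7 (exact template proved in tree:
`Literature.Geometry.DiscreteGeometry.IsKissingConfig.degree_le_four`, whose structure we mimic).

Proof.  Fix `v = p i` and project its contacts to the plane orthogonal to the axis `u - v`, using
lead c4's cylindrical frame `link_frame` and the windows `link_vpoint` (valid for `η ≤ 1/1000`).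
The projected unit vectors `e_j` satisfy: any two contacts `j ≠ k` of `v` (at distance `≥ 1 - η`)
have `⟪e_j, e_k⟫ ≤ 0.344` (`sdeg_vany`, azimuth `≥ 69.88°`); a soft-contact pair has
`⟪e_j, e_k⟫ ≥ 0.323` (`sdeg_vcontactLower`, azimuth `≤ 71.16°`); a gap pair (`≥ 7/5 ≥ 131/100`)
has `⟪e_j, e_k⟫ ≤ -0.136` (c4's `link_vfar`, azimuth `≥ 97.8°`).  Five contacts, sorted by the
argument `θ = arg (x + iy)` of their projections, give five cyclic gaps `≥ arccos 0.344 > π/4`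
summing to `2π`, so each gap is `≤ 2π - 4 arccos 0.344 ≤ π` with cosine
`≥ cos (4 arccos 0.344) = 0.1653… > -0.136`; hence every gap is a contact pair, `≤ arccos 0.323`,
and `5 arccos 0.323 ≤ 5 (π/2 - 0.323) < 2π` — contradiction (`sdeg_five_gaps_false`).

Contents: Part A trigonometric constants; Part B five gaps / five sorted angles; Part C five
planar unit directions; Part D scalar and frame bounds for pairs; Part E no five soft contacts and
the registered stub (`Set.ncard` extraction of five distinct contacts).

Mathlib + the landed c4 toolkit (`link_frame`, `link_vpoint`, `link_prod`, `link_vfar`); no named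
fact is used.
-/

noncomputable section

namespace Summit.AtomisticToContinuum.Crystallization.Theorems.ZeroDefectDensityBirth

open Real
open scoped InnerProductSpace

/-! ## Part A. Trigonometric constants -/

/-- `cos (4 · arccos c) = 8c⁴ - 8c² + 1` for `|c| ≤ 1`. [folklore] -/
theorem sdeg_cos_four_mul_arccos {c : ℝ} (h1 : -1 ≤ c) (h2 : c ≤ 1) :
    cos (4 * arccos c) = 8 * c ^ 4 - 8 * c ^ 2 + 1 := by
  have h : 4 * arccos c = 2 * (2 * arccos c) := by ring
  rw [h, cos_two_mul, cos_two_mul, cos_arccos h1 h2]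
  ring

/-- `-0.136 < cos (4 · arccos 0.344)` (the right-hand side is `0.1653…`). [folklore] -/
theorem sdeg_cos_four_mul_arccos_gt : -0.136 < cos (4 * arccos (0.344 : ℝ)) := by
  rw [sdeg_cos_four_mul_arccos (by norm_num) (by norm_num)]
  norm_num

/-- `π/4 < arccos 0.344` (as `0.344 < √2/2`). [folklore] -/
theorem sdeg_pi_div_four_lt_arccos : π / 4 < arccos (0.344 : ℝ) := by
  rw [← not_le, arccos_le_pi_div_four, not_le, lt_div_iff₀ (by norm_num : (0 : ℝ) < 2)]
  rw [show (0.344 * 2 : ℝ) = √((0.344 * 2) ^ 2) from (sqrt_sq (by norm_num)).symm]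
  exact sqrt_lt_sqrt (by norm_num) (by norm_num)

/-- `5 · arccos 0.323 < 2π`: `arccos 0.323 = π/2 - arcsin 0.323 ≤ π/2 - 0.323` (as
`sin 0.323 < 0.323`) and `π < 3.23`. [folklore] -/
theorem sdeg_five_mul_arccos_lt : 5 * arccos (0.323 : ℝ) < 2 * π := by
  have h1 : (0.323 : ℝ) ≤ arcsin 0.323 := by
    rw [le_arcsin_iff_sin_le' ⟨by linarith [pi_gt_three], by linarith [pi_gt_three]⟩]
    exact (sin_lt (by norm_num)).le
  rw [arccos_eq_pi_div_two_sub_arcsin]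
  linarith [pi_lt_d2]

/-- A nonnegative angle whose cosine is `≤ c` is at least `arccos c`. [folklore] -/
theorem sdeg_arccos_le_of_cos_le {g c : ℝ} (h0 : 0 ≤ g) (hc : cos g ≤ c) : arccos c ≤ g := by
  by_cases hg : g ≤ π
  · calc arccos c ≤ arccos (cos g) := arccos_le_arccos hc
      _ = g := arccos_cos h0 hg
  · exact (arccos_le_pi _).trans (le_of_lt (not_le.1 hg))

/-- An angle in `[0, π]` whose cosine is `≥ c` is at most `arccos c`. [folklore] -/
theorem sdeg_le_arccos_of_le_cos {g c : ℝ} (h0 : 0 ≤ g) (hπ : g ≤ π) (hc : c ≤ cos g) :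
    g ≤ arccos c := by
  calc g = arccos (cos g) := (arccos_cos h0 hπ).symm
    _ ≤ arccos c := arccos_le_arccos hc

/-! ## Part B. Five gaps around a circle -/

/-- **No five soft gaps.** Five nonnegative angles summing to `2π`, each with cosine `≤ 0.344`
and each either with cosine `≥ 0.323` (a soft contact pair) or `≤ -0.136` (a gap pair), do not
exist: each is `≥ α = arccos 0.344 > π/4`, hence `≤ 2π - 4α ≤ π` with cosine
`≥ cos 4α > -0.136`, so it is a contact pair and `≤ arccos 0.323`; but `5 arccos 0.323 < 2π`.
[folklore] -/
theorem sdeg_five_gaps_false (g : Fin 5 → ℝ) (h0 : ∀ k, 0 ≤ g k)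
    (hsum : g 0 + g 1 + g 2 + g 3 + g 4 = 2 * π) (hc : ∀ k, cos (g k) ≤ 0.344)
    (hd : ∀ k, 0.323 ≤ cos (g k) ∨ cos (g k) ≤ -0.136) : False := by
  set α := arccos (0.344 : ℝ) with hα
  have hlow : ∀ k, α ≤ g k := fun k => sdeg_arccos_le_of_cos_le (h0 k) (hc k)
  have hpi4 : π / 4 < α := sdeg_pi_div_four_lt_arccos
  have hup : ∀ k, g k ≤ 2 * π - 4 * α := by
    intro k
    have h0' := hlow 0; have h1' := hlow 1; have h2' := hlow 2; have h3' := hlow 3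
    have h4' := hlow 4
    fin_cases k <;> simp only [Fin.zero_eta, Fin.mk_one, Fin.reduceFinMk] <;> linarith
  have hle : ∀ k, g k ≤ arccos 0.323 := by
    intro k
    have hk1 : g k ≤ π := by linarith [hup k]
    have hcos : cos (4 * α) ≤ cos (g k) := by
      rw [← cos_two_pi_sub]
      exact cos_le_cos_of_nonneg_of_le_pi (h0 k) (by linarith) (hup k)
    have hfar : ¬ cos (g k) ≤ -0.136 := fun h =>
      absurd ((sdeg_cos_four_mul_arccos_gt.trans_le hcos).trans_le h) (lt_irrefl _)
    exact sdeg_le_arccos_of_le_cos (h0 k) hk1 ((hd k).resolve_right hfar)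
  have h5 := sdeg_five_mul_arccos_lt
  linarith [hle 0, hle 1, hle 2, hle 3, hle 4]

/-- **No five sorted soft directions.** Five angles `-π < t₀ < t₁ < ⋯ < t₄ ≤ π` such that every
difference `tᵢ - tⱼ` (`i ≠ j`) has cosine `≤ 0.344`, and cosine `≥ 0.323` or `≤ -0.136`, do not
exist (apply `sdeg_five_gaps_false` to the four consecutive gaps and the wrap-around gap
`2π - (t₄ - t₀)`). [folklore] -/
theorem sdeg_five_sorted_angles_false (t : Fin 5 → ℝ) (hmono : StrictMono t)
    (hlo : -π < t 0) (hhi : t 4 ≤ π)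
    (hC : ∀ i j, i ≠ j → cos (t i - t j) ≤ 0.344 ∧
      (0.323 ≤ cos (t i - t j) ∨ cos (t i - t j) ≤ -0.136)) : False := by
  have h01 : t 0 < t 1 := hmono (by decide)
  have h12 : t 1 < t 2 := hmono (by decide)
  have h23 : t 2 < t 3 := hmono (by decide)
  have h34 : t 3 < t 4 := hmono (by decide)
  have hw : cos (2 * π - (t 4 - t 0)) = cos (t 4 - t 0) := cos_two_pi_sub _
  refine sdeg_five_gaps_false
    ![t 1 - t 0, t 2 - t 1, t 3 - t 2, t 4 - t 3, 2 * π - (t 4 - t 0)] ?_ ?_ ?_ ?_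
  · intro k
    fin_cases k <;> simp <;> linarith
  · simp only [Matrix.cons_val_zero, Matrix.cons_val_one, Matrix.cons_val]
    ring
  · intro k
    fin_cases k
    · simpa using (hC 1 0 (by decide)).1
    · simpa using (hC 2 1 (by decide)).1
    · simpa using (hC 3 2 (by decide)).1
    · simpa using (hC 4 3 (by decide)).1
    · simpa [hw] using (hC 4 0 (by decide)).1
  · intro k
    fin_cases k
    · simpa using (hC 1 0 (by decide)).2
    · simpa using (hC 2 1 (by decide)).2
    · simpa using (hC 3 2 (by decide)).2
    · simpa using (hC 4 3 (by decide)).2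
    · simpa [hw] using (hC 4 0 (by decide)).2

/-! ## Part C. Five unit directions of the plane -/

/-- **Polar form.** A unit vector `(X, Y)` of the plane is `(cos θ, sin θ)` with
`θ = arg (X + iY)`. [folklore] -/
theorem sdeg_eq_cos_sin_arg {X Y : ℝ} (h : X ^ 2 + Y ^ 2 = 1) :
    X = cos (Complex.arg ⟨X, Y⟩) ∧ Y = sin (Complex.arg ⟨X, Y⟩) := by
  have hn : ‖(⟨X, Y⟩ : ℂ)‖ = 1 := by
    rw [Complex.norm_def, Complex.normSq_mk, show X * X + Y * Y = 1 by linear_combination h,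
      Real.sqrt_one]
  refine ⟨?_, ?_⟩
  · have := Complex.norm_mul_cos_arg ⟨X, Y⟩
    rw [hn, one_mul] at this
    exact this.symm
  · have := Complex.norm_mul_sin_arg ⟨X, Y⟩
    rw [hn, one_mul] at this
    exact this.symm

/-- Hence `X X' + Y Y' = cos (θ - θ')` for two unit vectors of the plane. [folklore] -/
theorem sdeg_inner_eq_cos_sub {X Y X' Y' : ℝ} (h : X ^ 2 + Y ^ 2 = 1)
    (h' : X' ^ 2 + Y' ^ 2 = 1) :
    X * X' + Y * Y' = cos (Complex.arg ⟨X, Y⟩ - Complex.arg ⟨X', Y'⟩) := by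
  set θ := Complex.arg ⟨X, Y⟩ with hθ
  set θ' := Complex.arg ⟨X', Y'⟩ with hθ'
  obtain ⟨hX, hY⟩ := sdeg_eq_cos_sin_arg h
  obtain ⟨hX', hY'⟩ := sdeg_eq_cos_sin_arg h'
  rw [← hθ] at hX hY
  rw [← hθ'] at hX' hY'
  rw [cos_sub]
  linear_combination X' * hX + cos θ * hX' + Y' * hY + sin θ * hY'

/-- **No five soft directions in the plane.** Five unit vectors `e_k = (x_k, y_k)` of the plane
with `⟪e_k, e_l⟫ ≤ 0.344` and (`⟪e_k, e_l⟫ ≥ 0.323` or `⟪e_k, e_l⟫ ≤ -0.136`) for all `k ≠ l` do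
not exist: with `θ_k = arg (x_k + i y_k)` one has `⟪e_k, e_l⟫ = cos (θ_k - θ_l)`, the `θ_k` are
pairwise distinct (`cos 0 = 1 > 0.344`), and sorting them contradicts
`sdeg_five_sorted_angles_false`. [folklore] -/
theorem sdeg_five_directions_false (x y : Fin 5 → ℝ) (hxy : ∀ k, x k ^ 2 + y k ^ 2 = 1)
    (hC : ∀ k l, k ≠ l → x k * x l + y k * y l ≤ 0.344 ∧
      (0.323 ≤ x k * x l + y k * y l ∨ x k * x l + y k * y l ≤ -0.136)) : False := by
  set θ : Fin 5 → ℝ := fun k => Complex.arg ⟨x k, y k⟩ with hθdef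
  have hcos : ∀ k l, x k * x l + y k * y l = cos (θ k - θ l) := fun k l =>
    sdeg_inner_eq_cos_sub (hxy k) (hxy l)
  have hθinj : Function.Injective θ := by
    intro k l hkl
    by_contra hne
    have h := (hC k l hne).1
    rw [hcos, hkl, sub_self, cos_zero] at h
    norm_num at h
  have hC' : ∀ k l, k ≠ l → cos (θ k - θ l) ≤ 0.344 ∧
      (0.323 ≤ cos (θ k - θ l) ∨ cos (θ k - θ l) ≤ -0.136) := fun k l hkl => by
    rw [← hcos]
    exact hC k l hkl
  -- sort the five angles
  have hAcard : (Finset.univ.image θ).card = 5 := by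
    rw [Finset.card_image_of_injective _ hθinj, Finset.card_univ, Fintype.card_fin]
  let e := (Finset.univ.image θ).orderEmbOfFin hAcard
  have hmem : ∀ k, ∃ i, θ i = e k := by
    intro k
    have := (Finset.univ.image θ).orderEmbOfFin_mem hAcard k
    rw [Finset.mem_image] at this
    obtain ⟨i, -, hi⟩ := this
    exact ⟨i, hi⟩
  choose π' hπ' using hmem
  refine sdeg_five_sorted_angles_false (fun k => e k) e.strictMono ?_ ?_ ?_
  · show -π < e 0
    rw [← hπ' 0]
    exact Complex.neg_pi_lt_arg _
  · show e 4 ≤ π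
    rw [← hπ' 4]
    exact Complex.arg_le_pi _
  · intro i j hij
    have hne : π' i ≠ π' j := by
      intro h
      apply hij
      apply e.injective
      rw [← hπ' i, ← hπ' j, h]
    rw [← hπ' i, ← hπ' j]
    exact hC' _ _ hne

/-! ## Part D. Pairs of contacts in the frame -/

/-- Planar inner product of ANY pair of contacts of the vertex (`≥ 1 - η` apart): with
`g = ⟪bᵢ, bⱼ⟫ = P · D + αᵢ αⱼ` (`P = ρᵢ ρⱼ ≥ 0.7449`, `αᵢ, αⱼ ≥ 0.497`) and `g ≤ 0.5030005`,
`D ≤ 0.344`. [folklore] -/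
theorem sdeg_pairAny {g P Dd α₁ α₂ : ℝ} (hg : g = P * Dd + α₁ * α₂) (hP : 0.7449 ≤ P)
    (h₁ : 0.497 ≤ α₁) (h₂ : 0.497 ≤ α₂) (hg2 : g ≤ 0.5030005) : Dd ≤ 0.344 := by
  have hαα' : 0.247009 ≤ α₁ * α₂ := by
    nlinarith [mul_le_mul h₁ h₂ (by norm_num) (by linarith : 0 ≤ α₁)]
  by_contra h
  nlinarith [mul_lt_mul_of_pos_left (not_le.mp h) (by linarith : 0 < P)]

/-- Planar inner product of a soft CONTACT pair, lower bound: with `g ≥ 0.4970005`,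
`0 < P ≤ 0.755`, `αᵢ, αⱼ ≤ 0.503` (`αⱼ ≥ 0.497`), `D ≥ 0.323`. [folklore] -/
theorem sdeg_pairContactLower {g P Dd α₁ α₂ : ℝ} (hg : g = P * Dd + α₁ * α₂) (hP0 : 0 < P)
    (hP' : P ≤ 0.755) (h₁' : α₁ ≤ 0.503) (h₂ : 0.497 ≤ α₂) (h₂' : α₂ ≤ 0.503)
    (hg1 : 0.4970005 ≤ g) : 0.323 ≤ Dd := by
  have hαα : α₁ * α₂ ≤ 0.253009 := by
    nlinarith [mul_le_mul h₁' h₂' (by linarith) (by norm_num : (0 : ℝ) ≤ 0.503)]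
  by_contra h
  nlinarith [mul_lt_mul_of_pos_left (not_le.mp h) hP0]

/-- **Any pair of contacts in the frame**: two band points `n, m` of the vertex `c` at distance
`≥ 0.999` have `⟪e_n, e_m⟫ ≤ 0.344`. [folklore] -/
theorem sdeg_vany {c n m : EuclideanSpace ℝ (Fin 3)} {x y ρ α : EuclideanSpace ℝ (Fin 3) → ℝ}
    (hid : ∀ q q', 0 < ρ q → 0 < ρ q' →
      ⟪q, q'⟫_ℝ = ρ q * ρ q' * (x q * x q' + y q * y q') + α q * α q')
    (hn : 0.497 ≤ α (n - c) ∧ α (n - c) ≤ 0.503 ∧ 0.7449 ≤ ρ (n - c) ^ 2 ∧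
      ρ (n - c) ^ 2 ≤ 0.755 ∧ 0 < ρ (n - c) ∧ 0.998001 ≤ ‖n - c‖ ^ 2 ∧ ‖n - c‖ ^ 2 ≤ 1.002001)
    (hm : 0.497 ≤ α (m - c) ∧ α (m - c) ≤ 0.503 ∧ 0.7449 ≤ ρ (m - c) ^ 2 ∧
      ρ (m - c) ^ 2 ≤ 0.755 ∧ 0 < ρ (m - c) ∧ 0.998001 ≤ ‖m - c‖ ^ 2 ∧ ‖m - c‖ ^ 2 ≤ 1.002001)
    (h : 0.999 ≤ ‖n - m‖) : x (n - c) * x (m - c) + y (n - c) * y (m - c) ≤ 0.344 := by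
  obtain ⟨hα1, -, hρ1, hρ1', hρ1p, -, hB1'⟩ := hn
  obtain ⟨hα2, -, hρ2, hρ2', hρ2p, -, hB2'⟩ := hm
  rw [← sub_sub_sub_cancel_right n m c] at h
  obtain ⟨hP, -⟩ := link_prod hρ1p hρ2p hρ1 hρ1' hρ2 hρ2'
  have hD := norm_sub_sq_real (n - c) (m - c)
  have hD2 : 0.998001 ≤ ‖n - c - (m - c)‖ ^ 2 := by nlinarith [h]
  have hg2 : ⟪n - c, m - c⟫_ℝ ≤ 0.5030005 := by linarith
  exact sdeg_pairAny (hid _ _ hρ1p hρ2p) hP hα1 hα2 hg2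

/-- **A soft contact pair in the frame, lower bound**: two band points `n, m` of the vertex `c`
with `0.999 ≤ ‖n - m‖ ≤ 1.001` have `0.323 ≤ ⟪e_n, e_m⟫`. [folklore] -/
theorem sdeg_vcontactLower {c n m : EuclideanSpace ℝ (Fin 3)}
    {x y ρ α : EuclideanSpace ℝ (Fin 3) → ℝ}
    (hid : ∀ q q', 0 < ρ q → 0 < ρ q' →
      ⟪q, q'⟫_ℝ = ρ q * ρ q' * (x q * x q' + y q * y q') + α q * α q')
    (hn : 0.497 ≤ α (n - c) ∧ α (n - c) ≤ 0.503 ∧ 0.7449 ≤ ρ (n - c) ^ 2 ∧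
      ρ (n - c) ^ 2 ≤ 0.755 ∧ 0 < ρ (n - c) ∧ 0.998001 ≤ ‖n - c‖ ^ 2 ∧ ‖n - c‖ ^ 2 ≤ 1.002001)
    (hm : 0.497 ≤ α (m - c) ∧ α (m - c) ≤ 0.503 ∧ 0.7449 ≤ ρ (m - c) ^ 2 ∧
      ρ (m - c) ^ 2 ≤ 0.755 ∧ 0 < ρ (m - c) ∧ 0.998001 ≤ ‖m - c‖ ^ 2 ∧ ‖m - c‖ ^ 2 ≤ 1.002001)
    (h1 : 0.999 ≤ ‖n - m‖) (h2 : ‖n - m‖ ≤ 1.001) :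
    0.323 ≤ x (n - c) * x (m - c) + y (n - c) * y (m - c) := by
  obtain ⟨-, hα1', hρ1, hρ1', hρ1p, hB1, -⟩ := hn
  obtain ⟨hα2, hα2', hρ2, hρ2', hρ2p, hB2, -⟩ := hm
  rw [← sub_sub_sub_cancel_right n m c] at h1 h2
  obtain ⟨-, hP'⟩ := link_prod hρ1p hρ2p hρ1 hρ1' hρ2 hρ2'
  have hD := norm_sub_sq_real (n - c) (m - c)
  have hD2' : ‖n - c - (m - c)‖ ^ 2 ≤ 1.002001 := by nlinarith [h1, h2]
  have hg1 : 0.4970005 ≤ ⟪n - c, m - c⟫_ℝ := by linarith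
  exact sdeg_pairContactLower (hid _ _ hρ1p hρ2p) (mul_pos hρ1p hρ2p) hP' hα1' hα2 hα2' hg1

/-! ## Part E. No five soft contacts; the registered stub -/

/-- **No shell point has five soft contacts.**  For a centre `u`, a shell point `v` and five
points `n_k` with `dist u v, dist u (n k), dist v (n k) ∈ [1 - η, 1 + η]` (`η = 1/4000`) and
pairwise `dist (n k) (n l) ≥ 1 - η`, each pair either `≤ 1 + η` or `≥ 7/5`: contradiction.  In
c4's frame about the axis `u - v` the projected unit vectors satisfy the hypotheses of
`sdeg_five_directions_false` (`sdeg_vany`, `sdeg_vcontactLower`, `link_vfar`). [folklore] -/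
theorem sdeg_no_five_contacts (u v : EuclideanSpace ℝ (Fin 3))
    (n : Fin 5 → EuclideanSpace ℝ (Fin 3))
    (hv : 1 - 1 / 4000 ≤ dist u v ∧ dist u v ≤ 1 + 1 / 4000)
    (hn : ∀ k, 1 - 1 / 4000 ≤ dist u (n k) ∧ dist u (n k) ≤ 1 + 1 / 4000)
    (hvn : ∀ k, 1 - 1 / 4000 ≤ dist v (n k) ∧ dist v (n k) ≤ 1 + 1 / 4000)
    (hnn : ∀ k l, k ≠ l → 1 - 1 / 4000 ≤ dist (n k) (n l) ∧
      (dist (n k) (n l) ≤ 1 + 1 / 4000 ∨ 7 / 5 ≤ dist (n k) (n l))) : False := by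
  have ha : u - v ≠ 0 := by
    intro h
    have h1 := hv.1
    rw [dist_eq_norm, h, norm_zero] at h1
    norm_num at h1
  obtain ⟨x, y, ρ, α, hα, hρ0, hρ, hxy, hid⟩ := link_frame (u - v) ha
  have hη0 : (0 : ℝ) ≤ 1 / 4000 := by norm_num
  have hη : (1 / 4000 : ℝ) ≤ 1 / 1000 := by norm_num
  have P : ∀ k, 0.497 ≤ α (n k - v) ∧ α (n k - v) ≤ 0.503 ∧ 0.7449 ≤ ρ (n k - v) ^ 2 ∧
      ρ (n k - v) ^ 2 ≤ 0.755 ∧ 0 < ρ (n k - v) ∧ 0.998001 ≤ ‖n k - v‖ ^ 2 ∧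
      ‖n k - v‖ ^ 2 ≤ 1.002001 := by
    intro k
    have h1 := hv.1; have h2 := hv.2; have h3 := (hn k).1; have h4 := (hn k).2
    have h5 := (hvn k).1; have h6 := (hvn k).2
    rw [dist_eq_norm] at h1 h2 h3 h4 h5 h6
    rw [norm_sub_rev] at h1 h2
    exact link_vpoint hα hρ0 hρ hη0 hη h1 h2 h3 h4 h5 h6
  refine sdeg_five_directions_false (fun k => x (n k - v)) (fun k => y (n k - v))
    (fun k => hxy _ (P k).2.2.2.2.1) fun k l hkl => ?_
  obtain ⟨h1, h2⟩ := hnn k l hkl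
  rw [dist_eq_norm] at h1 h2
  refine ⟨sdeg_vany hid (P k) (P l) (by linarith), ?_⟩
  rcases h2 with h2 | h2
  · exact Or.inl (sdeg_vcontactLower hid (P k) (P l) (by linarith) (by linarith))
  · exact Or.inr (link_vfar hid (P k) (P l) (by linarith))

/-- **STUB K1 of the birth line — soft Lemma 7 (Hales 2012, Lemma 7, soft form at tolerance
`1/4000`, gap `7/5`)**, registered signature verbatim: in a `1/4000`-soft gapped twelve-shell
about `u`, every shell point `p i` has at most four soft contacts among the other eleven.  Proof:
five distinct contacts (extracted from `Set.ncard ≥ 5`) contradict `sdeg_no_five_contacts`.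
[folklore] -/
theorem stub_softDegreeLeFour : ∀ (u : EuclideanSpace ℝ (Fin 3)) (p : Fin 12 → EuclideanSpace ℝ (Fin 3)), (∀ i : Fin 12, 1 - 1 / 4000 ≤ dist u (p i) ∧ dist u (p i) ≤ 1 + 1 / 4000) → (∀ i j : Fin 12, i ≠ j → 1 - 1 / 4000 ≤ dist (p i) (p j) ∧ (dist (p i) (p j) ≤ 1 + 1 / 4000 ∨ 7 / 5 ≤ dist (p i) (p j))) → ∀ i : Fin 12, {j : Fin 12 | j ≠ i ∧ dist (p i) (p j) ≤ 1 + 1 / 4000}.ncard ≤ 4 := by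
  intro u p hu hp i
  by_contra h
  set T : Set (Fin 12) := {j : Fin 12 | j ≠ i ∧ dist (p i) (p j) ≤ 1 + 1 / 4000} with hT
  have hfin : T.Finite := T.toFinite
  rw [Set.ncard_eq_toFinset_card T hfin] at h
  obtain ⟨F, hF, hcard⟩ := Finset.exists_subset_card_eq (show 5 ≤ hfin.toFinset.card by omega)
  set e := (Finset.equivFinOfCardEq hcard).symm with he
  have hmem : ∀ k, ((e k : F) : Fin 12) ≠ i ∧ dist (p i) (p ((e k : F) : Fin 12)) ≤ 1 + 1 / 4000 :=
    fun k => by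
    have := hF (e k).2
    simpa [hT] using this
  refine sdeg_no_five_contacts u (p i) (fun k => p (e k)) (hu i) (fun k => hu _) (fun k => ?_)
    (fun k l hkl => ?_)
  · obtain ⟨hne, hle⟩ := hmem k
    exact ⟨(hp i _ (Ne.symm hne)).1, hle⟩
  · have hne : ((e k : F) : Fin 12) ≠ e l := fun h' =>
      hkl (e.injective (Subtype.val_injective h'))
    exact hp _ _ hne

end Summit.AtomisticToContinuum.Crystallization.Theorems.ZeroDefectDensityBirth
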